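import Summits.SmoothPoincare4.SmoothPoincare4.Theorems.ContractibleTwistedDoubleStandard.Negative.SphereAcyclicBisection

/-!
# `AcyclicBisectionRigidity` — negative-side support: the twisted-double stubs and the twins lever

Support lemmas for the crux
`Summit.SmoothPoincare4.SmoothPoincare4.Theses.ConvexBisection.AcyclicBisectionRigidity`
(stmt-SmoothPoincare4-10507) about the three registered stubs of the picked line
`Cruxes/AcyclicBisectionRigidity/Lines/minimal-factorisation-rigidity.lean`, from the standing
disprover's work file `Cruxes/AcyclicBisectionRigidity/Disproof.lean` §9 (every statement inline):

* `contractibleTwinTwistedDouble_of_crux`, `acyclicTwinTwistedDouble_of_crux` — the two residual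
  stubs (`stub_contractibleTwinTwistedDouble`, `stub_nonContractibleTwinTwistedDouble`: a homotopy
  4-sphere that is a contact twisted double `W ∪_ĉ W̄` of ONE contractible, resp. ℚ-acyclic, Stein
  domain is `S⁴`) are CONSEQUENCES OF THE CRUX ITSELF (twin data is an acyclic bisection with
  `W₁ = W₂`, `J₁ = J₂`); since the crux follows from `SmoothPoincare4`, neither stub can be refuted
  short of an exotic `S⁴`, and given the lever the crux is equivalent to their conjunction.
* `twins_contactDiffeomorph` — the lever `stub_minimalFactorisationTwins` ("the halves are contact
  twins") holds by `Diffeomorph.refl` whenever the two halves are the same Stein domain `(W, J)`: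
  its entire content is the existence of a contact-diffeomorphism between the halves, so it is
  refutable WITHOUT an exotic sphere by one contact ℚHS³ with two non-diffeomorphic ℚ-acyclic Stein
  fillings glued to a homotopy sphere (Disproof §9c lists three one-construction candidates).
-/

noncomputable section

-- The namespace is prescribed by the crux protocol (`Summit.<P>.<Sub>.Theorems.<Crux>.Negative`
-- with `P = Sub = SmoothPoincare4`), hence the duplicated component.
set_option linter.dupNamespace false

open scoped Manifold ContDiff Topology ContinuousMap
open Set Function Literature.Geometry.Symplectic Literature.AlgebraicTopology.SingularHomology
  CategoryTheory.Limits

namespace Summit.SmoothPoincare4.SmoothPoincare4.Theorems.AcyclicBisectionRigidity.Negative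

open Summit.SmoothPoincare4.SmoothPoincare4.Theses.ConvexBisection

/-- **The contractible twisted-double stub follows from the crux.** Given
`AcyclicBisectionRigidity`, a homotopy 4-sphere covered by two smooth embeddings of ONE compact
contractible Stein domain `(W, J)` meeting exactly along the images of `∂W` with matching complex
tangencies is diffeomorphic to `S⁴`: twin data is an acyclic bisection (`W₁ = W₂ = W`,
`J₁ = J₂ = J`; contractible spaces are ℚ-acyclic in positive degrees,
`isZero_singularHomology_of_contractibleSpace`). Hence this stub is refutable only by an exotic
`S⁴`. [folklore] -/
theorem contractibleTwinTwistedDouble_of_crux (h : AcyclicBisectionRigidity)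
    (M : Type) [TopologicalSpace M] [T2Space M] [SecondCountableTopology M]
    [ChartedSpace (EuclideanSpace ℝ (Fin 4)) M] [IsManifold (𝓡 4) ∞ M]
    (hM : M ≃ₕ Metric.sphere (0 : EuclideanSpace ℝ (Fin 5)) 1)
    (W : Type) [TopologicalSpace W] [ChartedSpace (EuclideanHalfSpace 4) W] [IsManifold (𝓡∂ 4) ∞ W]
    [CompactSpace W] [ContractibleSpace W] (J : SteinStructure W) (e₁ e₂ : W → M)
    (he₁ : Manifold.IsSmoothEmbedding (𝓡∂ 4) (𝓡 4) ∞ e₁)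
    (he₂ : Manifold.IsSmoothEmbedding (𝓡∂ 4) (𝓡 4) ∞ e₂)
    (hcover : range e₁ ∪ range e₂ = univ)
    (hseam₁ : range e₁ ∩ range e₂ = e₁ '' (𝓡∂ 4).boundary W)
    (hseam₂ : range e₁ ∩ range e₂ = e₂ '' (𝓡∂ 4).boundary W)
    (hξ : ∀ w w', e₁ w = e₂ w' →
      Submodule.map (mfderiv (𝓡∂ 4) (𝓡 4) e₁ w).toLinearMap (contactPlane J.J w) =
      Submodule.map (mfderiv (𝓡∂ 4) (𝓡 4) e₂ w').toLinearMap (contactPlane J.J w')) :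
    Nonempty (M ≃ₘ⟮𝓡 4, 𝓡 4⟯ Metric.sphere (0 : EuclideanSpace ℝ (Fin 5)) 1) :=
  h M hM ⟨W, _, _, _, _, W, _, _, _, _, J, J, e₁, e₂, he₁, he₂, hcover, hseam₁, hseam₂, hξ,
    fun _ hk => ⟨isZero_singularHomology_of_contractibleSpace ℚ ℚ (X := W) hk.ne',
      isZero_singularHomology_of_contractibleSpace ℚ ℚ (X := W) hk.ne'⟩⟩

/-- **The ℚ-acyclic twisted-double stub follows from the crux** (same twin reading, with
acyclicity of `W` as a hypothesis; the line's `¬ ContractibleSpace W` is not needed). Refutable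
only by an exotic `S⁴`. [folklore] -/
theorem acyclicTwinTwistedDouble_of_crux (h : AcyclicBisectionRigidity)
    (M : Type) [TopologicalSpace M] [T2Space M] [SecondCountableTopology M]
    [ChartedSpace (EuclideanSpace ℝ (Fin 4)) M] [IsManifold (𝓡 4) ∞ M]
    (hM : M ≃ₕ Metric.sphere (0 : EuclideanSpace ℝ (Fin 5)) 1)
    (W : Type) [TopologicalSpace W] [ChartedSpace (EuclideanHalfSpace 4) W] [IsManifold (𝓡∂ 4) ∞ W]
    [CompactSpace W] (J : SteinStructure W) (e₁ e₂ : W → M)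
    (he₁ : Manifold.IsSmoothEmbedding (𝓡∂ 4) (𝓡 4) ∞ e₁)
    (he₂ : Manifold.IsSmoothEmbedding (𝓡∂ 4) (𝓡 4) ∞ e₂)
    (hcover : range e₁ ∪ range e₂ = univ)
    (hseam₁ : range e₁ ∩ range e₂ = e₁ '' (𝓡∂ 4).boundary W)
    (hseam₂ : range e₁ ∩ range e₂ = e₂ '' (𝓡∂ 4).boundary W)
    (hξ : ∀ w w', e₁ w = e₂ w' →
      Submodule.map (mfderiv (𝓡∂ 4) (𝓡 4) e₁ w).toLinearMap (contactPlane J.J w) =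
      Submodule.map (mfderiv (𝓡∂ 4) (𝓡 4) e₂ w').toLinearMap (contactPlane J.J w'))
    (hac : ∀ k, 0 < k → IsZero (singularHomology ℚ ℚ W k)) :
    Nonempty (M ≃ₘ⟮𝓡 4, 𝓡 4⟯ Metric.sphere (0 : EuclideanSpace ℝ (Fin 5)) 1) :=
  h M hM ⟨W, _, _, _, _, W, _, _, _, _, J, J, e₁, e₂, he₁, he₂, hcover, hseam₁, hseam₂, hξ,
    fun k hk => ⟨hac k hk, hac k hk⟩⟩

/-- **The twins lever is trivial on twin data.** For ONE compact Stein domain `(W, J)` the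
conclusion of the line's `stub_minimalFactorisationTwins` — a diffeomorphism `Φ : W ≅ W` whose
differential carries `contactPlane J.J` to itself at every boundary point — holds with
`Φ = Diffeomorph.refl`, with no hypothesis on the ambient manifold or the embeddings. So every
bisection with `(W₁, J₁) = (W₂, J₂)` (doubles `D(W)`, presentation spheres, the standard `S³/Q₈`
bisection of `S⁴`, Stein-compatible cork twists `W ∪_τ W̄`) satisfies the lever for free, and a
refutation of the lever must use two halves that are not contact-diffeomorphic. [folklore] -/
theorem twins_contactDiffeomorph {W : Type} [TopologicalSpace W]
    [ChartedSpace (EuclideanHalfSpace 4) W] [IsManifold (𝓡∂ 4) ∞ W] [CompactSpace W]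
    (J : SteinStructure W) :
    ∃ Φ : W ≃ₘ⟮𝓡∂ 4, 𝓡∂ 4⟯ W, ∀ w, w ∈ (𝓡∂ 4).boundary W →
      Submodule.map (mfderiv (𝓡∂ 4) (𝓡∂ 4) Φ w).toLinearMap (contactPlane J.J w) =
        contactPlane J.J (Φ w) := by
  refine ⟨Diffeomorph.refl _ _ _, fun w _ => ?_⟩
  have h : ((Diffeomorph.refl (𝓡∂ 4) W ∞ : W ≃ₘ⟮𝓡∂ 4, 𝓡∂ 4⟯ W) : W → W) = id := rfl
  rw [h, mfderiv_id]
  exact Submodule.map_id _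

/-- **At the round sphere the lever's hypotheses are met and its conclusion holds**: the
hemisphere bisection `S⁴ = 𝔻⁴ ∪_id 𝔻⁴` (`acyclicBisection_sphere`, p70210) has twin halves, so
`twins_contactDiffeomorph` applies — no refutation of the lever from `S⁴` with these halves.
[folklore] -/
theorem twins_contactDiffeomorph_closedBall :
    ∃ Φ : (Metric.closedBall (0 : EuclideanSpace ℝ (Fin 4)) 1) ≃ₘ⟮𝓡∂ 4, 𝓡∂ 4⟯
        (Metric.closedBall (0 : EuclideanSpace ℝ (Fin 4)) 1),
      ∀ w, w ∈ (𝓡∂ 4).boundary (Metric.closedBall (0 : EuclideanSpace ℝ (Fin 4)) 1) →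
        Submodule.map (mfderiv (𝓡∂ 4) (𝓡∂ 4) Φ w).toLinearMap
            (contactPlane steinStructureClosedBall.J w) =
          contactPlane steinStructureClosedBall.J (Φ w) :=
  twins_contactDiffeomorph steinStructureClosedBall

end Summit.SmoothPoincare4.SmoothPoincare4.Theorems.AcyclicBisectionRigidity.Negative
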